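import Summits.CriticalPhenomena.PercolationContinuityZ3.Theses.PercLowPointHalfSpace
import Summits.CriticalPhenomena.PercolationContinuityZ3.Theorems.PercLowPointHalfSpaceQuantitativeBGNKlTransfer
import Summits.CriticalPhenomena.PercolationContinuityZ3.Theorems.PercLowPointHalfSpaceQuantitativeBGNMirrorSymm
import Summits.CriticalPhenomena.PercolationContinuityZ3.Theorems.PercLowPointHalfSpaceQuantitativeBGNMirrorTwoGhost
import Summits.CriticalPhenomena.PercolationContinuityZ3.Theorems.PercLowPointHalfSpaceQuantitativeBGNMirrorSealing
import Literature.Probability.Percolation.TwoGhostInequalityProofs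
import Literature.Probability.Percolation.ConstrainedClusters
import Literature.Probability.Percolation.FiniteEnergy
import Literature.Probability.Percolation.HalfSpace
import Literature.Probability.Percolation.MeanFieldBetaFromGamma
import Literature.Probability.Percolation.CriticalContinuityProofs
import HarnessLib.Audit

/-!
# Line `mirror-akn-two-arm-import` (volume form) — skeleton for crux
# `PercLowPointHalfSpace.QuantitativeBGN` (item stmt-CriticalPhenomena-0913)

Lead: prover-line-stmt-CriticalPhenomena-0913-c1-0 (continuation lead c1, 2026-08-16), v3. The single OPEN
registered stub is `stub_mirrorNonCoalescenceRel` (name and signature of the concurrent lead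
prover-line-stmt-CriticalPhenomena-0913-1's registration, 11:36Z). The thin-foot attack on it
(`stub_thinFootRel ⇒ sealing ⇒ NonCoalescenceRel`) is kept below only as a RECORDED DEAD SUB-ROUTE: the packing
bound `P_{p_c}(volDn n ∩ footLe k) ≤ k(1−p_c)^{-k}/n` (lead c1, `Theorems/…ThinFootPacking.lean` +
`…ThinFootCostume.lean`: BGN + finite energy + vertex mass transport) makes `stub_thinFootRel` imply
`w(n) ≤ C n^{-(1−b)/(K+1)}` and the crux DIRECTLY, with a better exponent and without two-ghost — a costume.

MIRROR SQUARING. Put the wall between the layers `x₀ = 0` and `x₀ = 1`: the lower half-space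
`H⁻ = {x₀ ≤ 0}` rooted at `0` and the upper half-space `H⁺ = {x₀ ≥ 1}` rooted at `e₀ = (1,0,0)` carry
INDEPENDENT copies of the half-space cluster (disjoint edge sets, `mirrorIndep`), each distributed like
the cluster of the origin of the induced half-space graph (STUB 1, LANDED p96791), so
`P(volUp n ∩ volDn n) = w(n)²`, `w(n) = P^H(|C_H(o)| ≥ n)`. On the further event that the two BULK
clusters of `0` and `e₀` are distinct the configuration lies in Hutchcroft's two-cluster event `𝒮_{e,n}`
(STUB 2, LANDED p97823), of probability `≤ 396 √((1−p)/(pn))` (two-ghost, PROVED in the tree).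

RELATIVE NON-COALESCENCE (the reshaping). It is enough that the non-coalescence probability be
polynomial RELATIVE TO A POWER OF THE TAIL ITSELF:
`MirrorNonCoalescenceRel(K, b)`: `c n^{-b} P(volUp ∩ volDn) · w(n)^K ≤ P(volUp ∩ volDn ∩ distinct)`,
`b < 1/2` — then `c n^{-b} w^{K+2} ≤ C₀ n^{-1/2}` and `w(n) ≤ (C₀/c)^{1/(K+2)} n^{-(1/2−b)/(K+2)}`,
still a power law (`volumeTail_of_nonCoalescenceRel`). And by DIRECT SEALING (LANDED p98821,
`Theorems.mirror_sealing_bound`: closing the `≤ k` vertical edges above a thin foot seals the lower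
cluster and separates the bulk clusters) relative non-coalescence follows from a ONE-CLUSTER statement:
`ThinFootRel(k, K, b)`: `c n^{-b} w(n)^{K+1} ≤ P(volDn n ∩ {|foot| ≤ k})` — "half-space clusters of
volume `≥ n` touching the wall in at most `k` sites are not rarer than `n^{-b} w(n)^{K+1}`"
(`nonCoalescenceRel_of_thinFootRel`) — BUT that one-cluster statement is a costume (above), so it is NOT the
line's stub. The line is: `stub_mirrorNonCoalescenceRel` (OPEN, hardest) ⇒ volume tail ⇒ crux through the LANDED
station `Theorems.quantitativeBGN_of_surfaceVolumeTail` (p91667), exponent `a = (1/2 − b)/(K + 2)`.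

Why the reshaped stub is the right residual (numbers): the strict form (`K = 0`, non-coalescence
`≥ c n^{-b}`, b < 1/2) has b_eff ≈ 0.2–0.3 measured but an asymptotic threat (dock count `~ R^{2−2x_s}`,
marginal); the relative form with `K = 1` only asks `q_n ≥ c n^{-b} w(n)` — measured `q_n ≈ n^{-0.23}`
against `w(n) ≈ n^{-0.39}`: margin `0.39 + 0.5 − 0.23`. The thin-foot route would need `ζ < 1/2 + β_s K` for the
foot lower-tail exponent (measured `ζ ≈ 0.8 = 1 − (β_s − β_bulk)`: thin-footed half-space clusters ARE bulk
clusters hanging below their top vertex), and the packing identity behind that reading is exactly what makes the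
route a costume (lead c1 MC, `mc-thinfoot-docks-c1.md`; `thinFootRel-costume-c1.md`).

Disproof used (Cruxes/QuantitativeBGN/Disproof.lean v5): `p = p_c` enters only in the open stub
(independence, STUBS 1–2, sealing, two-ghost and the algebra hold at every `p ∈ (0,1]`; the `p > p_c`
form of relative non-coalescence is refuted — it would give a power-law arm decay above `p_c`,
`Theorems.mirrorNonCoalescence_false_of_criticalProb_lt` pattern); `n ≥ 1` is used in the algebra;
output `a = (1/2 − b)/(K+2) ≤ 1/4` is inside the admissible window `(0, 2]` of `Negative.armH_lower_bound`.
-/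

noncomputable section

namespace Summit.CriticalPhenomena.PercolationContinuityZ3.Cruxes.QuantitativeBGN.MirrorAknTwoArmImport

open MeasureTheory Filter
open Literature.Probability.Percolation Literature.Probability.LatticeModels
open scoped ENNReal Topology

/-! ### Objects -/

/-- `volUp n`: the `H⁺`-cluster of `e₀` has at least `n` vertices. -/
def volUp (n : ℕ) : Set (BondConfig (Site 3)) :=
  {ω | (n : ℕ∞) ≤ (openClusterIn (withinGraph (zdGraph 3) {x : Site 3 | 1 ≤ x 0}) ω (Pi.single 0 1)).encard}

/-- `volDn n`: the `H⁻`-cluster of `0` has at least `n` vertices. -/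
def volDn (n : ℕ) : Set (BondConfig (Site 3)) :=
  {ω | (n : ℕ∞) ≤ (openClusterIn (withinGraph (zdGraph 3) {x : Site 3 | x 0 ≤ 0}) ω 0).encard}

/-- `footLe k`: the `H⁻`-cluster of `0` touches the wall `{x₀ = 0}` in at most `k` sites. -/
def footLe (k : ℕ) : Set (BondConfig (Site 3)) :=
  {ω | (openClusterIn (withinGraph (zdGraph 3) {x : Site 3 | x 0 ≤ 0}) ω 0 ∩ {x : Site 3 | x 0 = 0}).encard ≤ k}

/-- `distinct`: the bulk clusters of `0` and `e₀` are different. -/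
def distinct : Set (BondConfig (Site 3)) :=
  {ω | ¬ (openGraph ω).Reachable (0 : Site 3) (Pi.single 0 1)}

/-- Hutchcroft's two-cluster event `𝒮_{e,n}` at the edge `e = {0, e₀}` of `ℤ³` (verbatim). -/
def twoGhostEv (n : ℕ) : Set (BondConfig (Site 3)) :=
  {ω | s((0 : Site 3), (Pi.single 0 1 : Site 3)) ∉ ω ∧ ¬ (openGraph ω).Reachable (0 : Site 3) (Pi.single 0 1) ∧
      (n : ℕ∞) ≤ {e ∈ (zdGraph 3).edgeSet | ∃ v ∈ e, v ∈ openCluster ω (0 : Site 3)}.encard ∧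
      (n : ℕ∞) ≤ {e ∈ (zdGraph 3).edgeSet | ∃ v ∈ e, v ∈ openCluster ω (Pi.single 0 1 : Site 3)}.encard ∧
      ((openCluster ω (0 : Site 3)).Finite ∨ (openCluster ω (Pi.single 0 1 : Site 3)).Finite)}

/-- The half-space volume tail on the induced graph: `w_p(n) = P^H_p(|C_H(o)| ≥ n)`. -/
def w (p : unitInterval) (n : ℕ) : ℝ :=
  (bondPercolation (halfSpaceGraph 3) p).real (clusterSizeGe (halfSpaceOrigin 3) n)

/-- Shorthand for `P_p` on `ℤ³`. -/
abbrev P3 (p : unitInterval) : Measure (BondConfig (Site 3)) := bondPercolation (zdGraph 3) p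

/-! ### Named statements -/

/-- STUB 1 statement (landed). -/
def MirrorSymm : Prop :=
  ∀ (p : unitInterval) (n : ℕ), (P3 p).real (volUp n) = w p n ∧ (P3 p).real (volDn n) = w p n

/-- STUB 2 statement (landed). -/
def MirrorTwoGhost : Prop :=
  ∀ (p : unitInterval) (n : ℕ), (P3 p).real (volUp n ∩ volDn n ∩ distinct) ≤ (P3 p).real (twoGhostEv n)

/-- RELATIVE mirror non-coalescence at `p` with volume-tail power `K` (the concurrent lead's reshaping of
STUB 3): `∃ K b c, b < 1/2, 0 < c, ∀ n ≥ 1, c n^{-b} P(volUp ∩ volDn) P(volDn)^K ≤ P(volUp ∩ volDn ∩ distinct)`. -/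
def MirrorNonCoalescenceRelAt (p : unitInterval) : Prop :=
  ∃ (K : ℕ) (b c : ℝ), b < 1 / 2 ∧ 0 < c ∧ ∀ n : ℕ, 1 ≤ n →
    c * (n : ℝ) ^ (-b) * (P3 p).real (volUp n ∩ volDn n) * (P3 p).real (volDn n) ^ K ≤
      (P3 p).real (volUp n ∩ volDn n ∩ distinct)

/-- RELATIVE thin-foot lower bound at `p`: `∃ k K b c, b < 1/2, 0 < c, ∀ n ≥ 1,
c n^{-b} P(volDn n)^{K+1} ≤ P(volDn n ∩ footLe k)`. -/
def ThinFootRelAt (p : unitInterval) : Prop :=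
  ∃ (k K : ℕ) (b c : ℝ), b < 1 / 2 ∧ 0 < c ∧ ∀ n : ℕ, 1 ≤ n →
    c * (n : ℝ) ^ (-b) * (P3 p).real (volDn n) ^ (K + 1) ≤ (P3 p).real (volDn n ∩ footLe k)

/-- The strict (original) STUB 3 at `p` (kept for the record; `K = 0` of the relative form). -/
def MirrorNonCoalescenceAt (p : unitInterval) : Prop :=
  ∃ b c : ℝ, b < 1 / 2 ∧ 0 < c ∧ ∀ n : ℕ, 1 ≤ n →
    c * (n : ℝ) ^ (-b) * (P3 p).real (volUp n ∩ volDn n) ≤ (P3 p).real (volUp n ∩ volDn n ∩ distinct)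

/-! ### The registered stubs (signatures verbatim) -/

/-- STUB 1 (M, LANDED p96791 — `Theorems.stub_mirrorSymm`) — both mirror volume events have probability
`w_p(n)`; lattice symmetries `zdShiftIso e₀`, reflection, and the restriction coupling ambient ↔ induced. -/
theorem stub_mirrorSymm :
    ∀ (p : unitInterval) (n : ℕ), (bondPercolation (zdGraph 3) p).real {ω | (n : ℕ∞) ≤ (openClusterIn (withinGraph (zdGraph 3) {x : Site 3 | 1 ≤ x 0}) ω (Pi.single 0 1)).encard} = (bondPercolation (halfSpaceGraph 3) p).real (clusterSizeGe (halfSpaceOrigin 3) n) ∧ (bondPercolation (zdGraph 3) p).real {ω | (n : ℕ∞) ≤ (openClusterIn (withinGraph (zdGraph 3) {x : Site 3 | x 0 ≤ 0}) ω 0).encard} = (bondPercolation (halfSpaceGraph 3) p).real (clusterSizeGe (halfSpaceOrigin 3) n) :=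
  Summit.CriticalPhenomena.PercolationContinuityZ3.Theorems.stub_mirrorSymm

/-- STUB 2 (M−, LANDED p97823 — `Theorems.stub_mirrorTwoGhost`) — the squared-and-distinct event lies in
`𝒮_{e,n}` (closed edge, distinct, both bulk clusters touch `≥ n` lattice edges, one finite a.s.). -/
theorem stub_mirrorTwoGhost :
    ∀ (p : unitInterval) (n : ℕ), (bondPercolation (zdGraph 3) p).real ({ω | (n : ℕ∞) ≤ (openClusterIn (withinGraph (zdGraph 3) {x : Site 3 | 1 ≤ x 0}) ω (Pi.single 0 1)).encard} ∩ {ω | (n : ℕ∞) ≤ (openClusterIn (withinGraph (zdGraph 3) {x : Site 3 | x 0 ≤ 0}) ω 0).encard} ∩ {ω | ¬ (openGraph ω).Reachable (0 : Site 3) (Pi.single 0 1)}) ≤ (bondPercolation (zdGraph 3) p).real {ω | s((0 : Site 3), (Pi.single 0 1 : Site 3)) ∉ ω ∧ ¬ (openGraph ω).Reachable (0 : Site 3) (Pi.single 0 1) ∧ (n : ℕ∞) ≤ {e ∈ (zdGraph 3).edgeSet | ∃ v ∈ e, v ∈ openCluster ω (0 : Site 3)}.encard ∧ (n : ℕ∞)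 ≤ {e ∈ (zdGraph 3).edgeSet | ∃ v ∈ e, v ∈ openCluster ω (Pi.single 0 1 : Site 3)}.encard ∧ ((openCluster ω (0 : Site 3)).Finite ∨ (openCluster ω (Pi.single 0 1 : Site 3)).Finite)} :=
  Summit.CriticalPhenomena.PercolationContinuityZ3.Theorems.stub_mirrorTwoGhost

/-- STUB 3 (XL, OPEN, HARDEST — `stub_mirrorNonCoalescenceRel`, registered 11:36Z by prover-line-stmt-CriticalPhenomena-0913-1,
signature verbatim): RELATIVE mirror non-coalescence at `p_c(ℤ³)` — there are `K : ℕ`, `b < 1/2`, `c > 0` with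
`c n^{-b} P(volUp n ∩ volDn n) P(volDn n)^K ≤ P(volUp n ∩ volDn n ∩ {0 ↮ e₀})` for every `n ≥ 1`, i.e.
`q_n = P(distinct | both) ≥ c n^{-b} w(n)^K`. Numerically `q_n ≈ n^{-0.25}` (docks `E[D0] ≈ 1.6 ln n`), so `K = 1, b = 0`
holds with room; the strict form `K = 0` is the original STUB 3. Its only costume-free mechanism is dock/indirect-chain
control for TYPICAL (thick-footed) pairs, i.e. boundary two-point/density decay at `p_c` — no tool exists; the
thin-foot sufficient condition is a costume (module docstring). FALSE at every `p > p_c` (same squaring gives a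
power-law arm decay above `p_c`, cf. `Theorems.mirrorNonCoalescence_false_of_criticalProb_lt`). -/
theorem stub_mirrorNonCoalescenceRel :
    ∃ (K : ℕ) (b c : ℝ), b < 1 / 2 ∧ 0 < c ∧ ∀ n : ℕ, 1 ≤ n → c * (n : ℝ) ^ (-b) * (bondPercolation (zdGraph 3) (criticalProbI 3)).real ({ω | (n : ℕ∞) ≤ (openClusterIn (withinGraph (zdGraph 3) {x : Site 3 | 1 ≤ x 0}) ω (Pi.single 0 1)).encard} ∩ {ω | (n : ℕ∞) ≤ (openClusterIn (withinGraph (zdGraph 3) {x : Site 3 | x 0 ≤ 0}) ω 0).encard}) * (bondPercolation (zdGraph 3) (criticalProbI 3)).real {ω | (n : ℕ∞) ≤ (openClusterIn (withinGraph (zdGraph 3) {x : Site 3 | x 0 ≤ 0}) ω 0).encard} ^ K ≤ (bondPercolation (zdGraph 3) (criticalProbI 3)).real ({ω | (n : ℕ∞) ≤ (openClusterIn (withinGraph (zdGraph 3) {x : Site 3 | 1 ≤ x 0}) ω (Pi.single 0 1)).encard} ∩ {ω | (n : ℕ∞) ≤ (openClusterIn (withinGraph (zdGraph 3) {x : Site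 3 | x 0 ≤ 0}) ω 0).encard} ∩ {ω | ¬ (openGraph ω).Reachable (0 : Site 3) (Pi.single 0 1)}) := by
  sorry

/-! ### Consistency: each named statement IS its registered stub (definitionally) -/

theorem mirrorSymm_holds : MirrorSymm := stub_mirrorSymm
theorem mirrorTwoGhost_holds : MirrorTwoGhost := stub_mirrorTwoGhost
theorem mirrorNonCoalescenceRel_holds : MirrorNonCoalescenceRelAt (criticalProbI 3) := stub_mirrorNonCoalescenceRel

/-! ### Proved plumbing: independence, two-ghost, algebra -/

/-- **Mirror independence** (via the landed `MirrorSealing` helpers): `P(volUp n ∩ volDn n) = P(volUp n) P(volDn n)`. -/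
theorem mirrorIndep (p : unitInterval) (n : ℕ) :
    (P3 p).real (volUp n ∩ volDn n) = (P3 p).real (volUp n) * (P3 p).real (volDn n) :=
  bondPercolation_real_inter_of_disjoint (zdGraph 3) p
    Summit.CriticalPhenomena.PercolationContinuityZ3.Theorems.MirrorSealing.disjoint_edgeSet_up_dn
    (Summit.CriticalPhenomena.PercolationContinuityZ3.Theorems.MirrorSealing.determinedBy_volUp n)
    (Summit.CriticalPhenomena.PercolationContinuityZ3.Theorems.MirrorSealing.determinedBy_setOf_openClusterIn
      (fun C => (n : ℕ∞) ≤ C.encard))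
    (Summit.CriticalPhenomena.PercolationContinuityZ3.Theorems.MirrorSealing.measurableSet_volUp n)
    (Summit.CriticalPhenomena.PercolationContinuityZ3.Theorems.MirrorSealing.measurableSet_volDn n)

/-- `0 ∼ e₀` in `ℤ³`. -/
theorem adj_zero_e0 : (zdGraph 3).Adj (0 : Site 3) (Pi.single 0 1) :=
  (zdGraph_adj_iff _ _).2 ⟨0, Or.inl (by simp)⟩

/-- **Two-ghost bound** (Hutchcroft 2020 Cor. 1.7, in tree): `P_p(𝒮_{e,n}) ≤ 66·(2·3)·√((1−p)/(pn))`. -/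
theorem twoGhost_bound (p : unitInterval) (hp : 0 < (p : ℝ)) (n : ℕ) (hn : 1 ≤ n) :
    (P3 p).real (twoGhostEv n) ≤ 66 * (2 * (3 : ℝ)) * Real.sqrt ((1 - (p : ℝ)) / ((p : ℝ) * n)) :=
  Hutchcroft2020_twoGhost_corollary_holds 3 (by norm_num) p hp n hn 0 (Pi.single 0 1) adj_zero_e0

/-- `√((1−p)/(pn)) ≤ √(1/p) · n^{-1/2}` for real `p > 0`, `n ≥ 1`. -/
theorem sqrt_ratio_le (p : ℝ) (hp : 0 < p) (n : ℕ) (hn : 1 ≤ n) :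
    Real.sqrt ((1 - p) / (p * n)) ≤ Real.sqrt (1 / p) * (n : ℝ) ^ (-(1 / 2 : ℝ)) := by
  have hn0 : (0 : ℝ) < n := by exact_mod_cast hn
  have e1 : (n : ℝ) ^ (-(1 / 2 : ℝ)) = Real.sqrt ((n : ℝ)⁻¹) := by
    rw [Real.sqrt_eq_rpow, ← Real.rpow_neg_one, ← Real.rpow_mul hn0.le]
    norm_num
  rw [e1, ← Real.sqrt_mul (by positivity)]
  apply Real.sqrt_le_sqrt
  rw [div_le_iff₀ (by positivity)]
  have : 1 / p * (n : ℝ)⁻¹ * (p * n) = 1 := by field_simp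
  rw [this]
  linarith

/-- **From a power bound to a tail bound**: if `0 ≤ w`, `0 < c`, `0 ≤ C₀`, `1 ≤ m` and
`c n^{-b} w^m ≤ C₀ n^{-s}` with `n ≥ 1`, then `w ≤ (C₀/c)^{1/m} · n^{-((s−b)/m)}`. -/
theorem tail_bound_of_pow_bound {w c C₀ b s : ℝ} {n m : ℕ} (hn : 1 ≤ n) (hm : 1 ≤ m) (hw : 0 ≤ w)
    (hc : 0 < c) (hC : 0 ≤ C₀) (h : c * (n : ℝ) ^ (-b) * w ^ m ≤ C₀ * (n : ℝ) ^ (-s)) :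
    w ≤ (C₀ / c) ^ (1 / (m : ℝ)) * (n : ℝ) ^ (-((s - b) / m)) := by
  have hn0 : (0 : ℝ) < n := by exact_mod_cast hn
  have hm0 : (0 : ℝ) < m := by exact_mod_cast hm
  have hnb : 0 < (n : ℝ) ^ (-b) := Real.rpow_pos_of_pos hn0 _
  -- `w^m ≤ (C₀/c) n^{b - s}`
  have h2 : w ^ m ≤ C₀ / c * (n : ℝ) ^ (b - s) := by
    have e : C₀ / c * (n : ℝ) ^ (b - s) = C₀ * (n : ℝ) ^ (-s) / (c * (n : ℝ) ^ (-b)) := by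
      rw [show b - s = -s - -b by ring, Real.rpow_sub hn0]
      field_simp
    rw [e, le_div_iff₀ (mul_pos hc hnb)]
    linarith [h]
  -- take `m`-th roots
  have hwm : w = (w ^ m) ^ (1 / (m : ℝ)) := by
    rw [← Real.rpow_natCast w m, ← Real.rpow_mul hw, mul_one_div_cancel hm0.ne', Real.rpow_one]
  rw [hwm]
  refine (Real.rpow_le_rpow (pow_nonneg hw m) h2 (by positivity)).trans (le_of_eq ?_)
  rw [Real.mul_rpow (div_nonneg hC hc.le) (Real.rpow_nonneg hn0.le _), ← Real.rpow_mul hn0.le]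
  congr 2
  field_simp
  ring

/-! ### Composition -/

/-- RECORDED DEAD SUB-ROUTE (the hypothesis `ThinFootRelAt p_c` is a costume of the crux, see the module
docstring). **Direct sealing turns a relative thin-foot bound into relative non-coalescence** (any `p` with `p < 1`):
`P(volUp ∩ volDn ∩ distinct) ≥ (1−p)^k P(volUp) P(volDn ∩ footLe k) ≥ (1−p)^k c n^{-b} P(volUp) P(volDn)^{K+1}
= c (1−p)^k n^{-b} P(volUp ∩ volDn) P(volDn)^K` (landed `Theorems.mirror_sealing_bound` + independence). -/
theorem nonCoalescenceRel_of_thinFootRel (p : unitInterval) (hp1 : (p : ℝ) < 1) (h : ThinFootRelAt p) :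
    MirrorNonCoalescenceRelAt p := by
  obtain ⟨k, K, b, c, hb, hc, h⟩ := h
  have hq : 0 < (1 - (p : ℝ)) ^ k := pow_pos (by linarith) k
  refine ⟨K, b, c * (1 - (p : ℝ)) ^ k, hb, mul_pos hc hq, fun n hn => ?_⟩
  have hseal := Summit.CriticalPhenomena.PercolationContinuityZ3.Theorems.mirror_sealing_bound p n k
  have hU : 0 ≤ (P3 p).real (volUp n) := measureReal_nonneg
  calc c * (1 - (p : ℝ)) ^ k * (n : ℝ) ^ (-b) * (P3 p).real (volUp n ∩ volDn n) * (P3 p).real (volDn n) ^ K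
      = (1 - (p : ℝ)) ^ k * ((P3 p).real (volUp n) *
          (c * (n : ℝ) ^ (-b) * (P3 p).real (volDn n) ^ (K + 1))) := by
        rw [mirrorIndep]; ring
    _ ≤ (1 - (p : ℝ)) ^ k * ((P3 p).real (volUp n) * (P3 p).real (volDn n ∩ footLe k)) :=
        mul_le_mul_of_nonneg_left (mul_le_mul_of_nonneg_left (h n hn) hU) hq.le
    _ ≤ (P3 p).real (volUp n ∩ volDn n ∩ distinct) := hseal

/-- The strict form implies the relative form (`K = 0`). -/
theorem nonCoalescenceRel_of_strict (p : unitInterval) (h : MirrorNonCoalescenceAt p) :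
    MirrorNonCoalescenceRelAt p := by
  obtain ⟨b, c, hb, hc, h⟩ := h
  exact ⟨0, b, c, hb, hc, fun n hn => by simpa using h n hn⟩

/-- **Relative non-coalescence at `p > 0` ⇒ a polynomial volume tail at `p`**:
`w_p(n) ≤ (C₀/c)^{1/(K+2)} n^{-(1/2−b)/(K+2)}`, `C₀ = 396 √(1/p)`. -/
theorem volumeTail_of_nonCoalescenceRel (p : unitInterval) (hp : 0 < (p : ℝ)) (h1 : MirrorSymm)
    (h2 : MirrorTwoGhost) (h3 : MirrorNonCoalescenceRelAt p) :
    ∃ b' C : ℝ, 0 < b' ∧ ∀ n : ℕ, 1 ≤ n → w p n ≤ C * (n : ℝ) ^ (-b') := by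
  obtain ⟨K, b, c, hb, hc, h⟩ := h3
  set C₀ : ℝ := 66 * (2 * (3 : ℝ)) * Real.sqrt (1 / (p : ℝ)) with hC₀
  have hC₀0 : 0 ≤ C₀ := by positivity
  have hK2 : (0 : ℝ) < ((K + 2 : ℕ) : ℝ) := by positivity
  refine ⟨(1 / 2 - b) / ((K + 2 : ℕ) : ℝ), (C₀ / c) ^ (1 / ((K + 2 : ℕ) : ℝ)), div_pos (by linarith) hK2,
    fun n hn => ?_⟩
  have hDn : (P3 p).real (volDn n) = w p n := (h1 p n).2
  have hsq : (P3 p).real (volUp n ∩ volDn n) = w p n ^ 2 := by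
    rw [mirrorIndep, (h1 p n).1, (h1 p n).2, sq]
  have hchain : c * (n : ℝ) ^ (-b) * w p n ^ (K + 2) ≤ C₀ * (n : ℝ) ^ (-(1 / 2 : ℝ)) := by
    calc c * (n : ℝ) ^ (-b) * w p n ^ (K + 2)
        = c * (n : ℝ) ^ (-b) * (P3 p).real (volUp n ∩ volDn n) * (P3 p).real (volDn n) ^ K := by
          rw [hsq, hDn]; ring
      _ ≤ (P3 p).real (volUp n ∩ volDn n ∩ distinct) := h n hn
      _ ≤ (P3 p).real (twoGhostEv n) := h2 p n
      _ ≤ 66 * (2 * (3 : ℝ)) * Real.sqrt ((1 - (p : ℝ)) / ((p : ℝ) * n)) := twoGhost_bound p hp n hn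
      _ ≤ 66 * (2 * (3 : ℝ)) * (Real.sqrt (1 / (p : ℝ)) * (n : ℝ) ^ (-(1 / 2 : ℝ))) :=
          mul_le_mul_of_nonneg_left (sqrt_ratio_le p hp n hn) (by norm_num)
      _ = C₀ * (n : ℝ) ^ (-(1 / 2 : ℝ)) := by rw [hC₀]; ring
  exact tail_bound_of_pow_bound hn (by omega) measureReal_nonneg hc hC₀0 hchain

/-- **The line's reduction at `p_c`**: STUBS 1–2 (landed) + relative non-coalescence ⇒ the polynomial volume
tail at `p_c` in the form consumed by `Theorems.quantitativeBGN_of_surfaceVolumeTail`. Uses `0 < p_c(ℤ³)`. -/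
theorem surfaceVolumeTail_of_nonCoalescenceRel (h1 : MirrorSymm) (h2 : MirrorTwoGhost)
    (h3 : MirrorNonCoalescenceRelAt (criticalProbI 3)) :
    ∃ b C : ℝ, 0 < b ∧ ∀ n : ℕ, 1 ≤ n →
      (bondPercolation (halfSpaceGraph 3) (criticalProbI 3)).real (clusterSizeGe (halfSpaceOrigin 3) n) ≤
        C * (n : ℝ) ^ (-b) :=
  volumeTail_of_nonCoalescenceRel (criticalProbI 3) (criticalProb_zd_pos 3 (by norm_num)) h1 h2 h3

/-! ### Name-keyed aliases (hypotheses of the composition) -/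
namespace Registered

/-- Alias of `MirrorSymm` keyed by the registered stub name (landed). -/
abbrev stub_mirrorSymm : Prop := MirrorSymm
/-- Alias of `MirrorTwoGhost` keyed by the registered stub name (landed). -/
abbrev stub_mirrorTwoGhost : Prop := MirrorTwoGhost
/-- Alias of `MirrorNonCoalescenceRelAt (criticalProbI 3)` keyed by the registered stub name (open). -/
abbrev stub_mirrorNonCoalescenceRel : Prop := MirrorNonCoalescenceRelAt (criticalProbI 3)

end Registered

/-- **`QuantitativeBGN` from the one open registered stub, BY NAME** (kernel-checked modulo that stub):
STUB 1 + STUB 2 (landed, discharged inside) + `stub_mirrorNonCoalescenceRel` (open) — via mirror independence, two-ghost (in tree),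
the `(K+2)`-nd-root algebra and the landed station `Theorems.quantitativeBGN_of_surfaceVolumeTail`;
exponent `a = (1/2 − b)/(K + 2)`. -/
theorem QuantitativeBGN_of (h3 : Registered.stub_mirrorNonCoalescenceRel) :
    Summit.CriticalPhenomena.PercolationContinuityZ3.Theses.PercLowPointHalfSpace.QuantitativeBGN :=
  -- STUBS 1 and 2 are LANDED theorems (p96791, p97823): discharged here, no longer hypotheses.
  Summit.CriticalPhenomena.PercolationContinuityZ3.Theorems.quantitativeBGN_of_surfaceVolumeTail
    (surfaceVolumeTail_of_nonCoalescenceRel mirrorSymm_holds mirrorTwoGhost_holds h3)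

/-- Wiring check: the one remaining registered stub feeds `QuantitativeBGN_of` as stated. -/
example : Summit.CriticalPhenomena.PercolationContinuityZ3.Theses.PercLowPointHalfSpace.QuantitativeBGN :=
  QuantitativeBGN_of mirrorNonCoalescenceRel_holds

end Summit.CriticalPhenomena.PercolationContinuityZ3.Cruxes.QuantitativeBGN.MirrorAknTwoArmImport

end
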